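import Literature.AlgebraicGeometry.Motives.ShearCocycleIdentity
import Mathlib.CategoryTheory.Monoidal.Cartesian.Mon
import HarnessLib

/-!
# The unit slice of the generic fibre: `m(ε, b) = b` (road W, (W0) L4c′, the `hpin` producer's unit law)

Topic `Literature/AlgebraicGeometry/Motives`, namespace `Literature.AlgebraicGeometry.Motives`.  THEOREMS ONLY.  Cell
`hodgecm-mathlib` (D-0151), fan B-III (T1) road W, node (W0), leaf L4c′ (B-p18 `W0CoreV2` `stub_L4c'`): the ONLY
place where the group `K`-scheme `E`, the isomorphism `e : 𝒳_K ≅ E`, the comparison `δ` of the generic-fibre functor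
and the hypothesis `hgen` («`m` is the group law of `E` on the generic fibre») enter the residue computation at the
`K`-point `(ε, ε)`: the slice `b ↦ (ε, b)` of the generic fibre `𝒳_K = 𝒳 ×_R Spec K` into the generic fibre
`U₀ ⊆ 𝒳 ×_R 𝒳` followed by the rational map `m : D → 𝒳` (`D ⊇ U₀`) is the inclusion `𝒳_K → 𝒳` — the left unit law
`ε · b = b` (`exists_unitSlice_comp_eq`, pullback level; `ε := η[E]` read through `e`, `x : Spec K → 𝒳` the
corresponding `K`-point, ★ `unitPoint_comp_hom`).  Banked leaf toward road W (r₀); no floor change.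

## References
* S. Bosch, W. Lütkebohmert, M. Raynaud, *Néron Models* (1990), §4.2 (invariant differentials: evaluation of the
  shear cocycle along the unit section). [BLRNeronModels1990]
-/

noncomputable section

universe u

open CategoryTheory CategoryTheory.Limits AlgebraicGeometry MonoidalCategory CartesianMonoidalCategory
open Literature.NumberTheory.EllipticCurves Literature.AlgebraicGeometry.Motives
open scoped MonObj CategoryTheory.Obj

namespace Literature.AlgebraicGeometry.Motives

variable {R : Type u} [CommRing R] {K : Type u} [Field K] [Algebra R K]
  (𝒳 : Over (Spec (.of R))) (E : Over (Spec (.of K))) [MonObj E] (e : (genericFibre R K).obj 𝒳 ≅ E)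

set_option backward.isDefEq.respectTransparency false in
/-- The two legs of the unit slice `b ↦ (ε, b)` agree over `Spec R`: `(𝒳_K → Spec K → ε ∈ 𝒳) → Spec R` equals
`(𝒳_K → 𝒳) → Spec R`. [cite: BLRNeronModels1990, §4.2 (the unit section)] -/
theorem unitSlice_w :
    (pullback.snd 𝒳.hom (specGenericPoint R K) ≫
        ((η[E].left ≫ e.inv.left) ≫ pullback.fst 𝒳.hom (specGenericPoint R K))) ≫ 𝒳.hom =
      pullback.fst 𝒳.hom (specGenericPoint R K) ≫ 𝒳.hom := by
  rw [Category.assoc, unitPoint_comp_hom 𝒳 E e]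
  exact pullback.condition.symm

/-- **Left unit law through `e`, in `Over (Spec K)`**: the slice `(ε, 𝟙) : 𝒳_K → 𝒳_K ⊗ 𝒳_K ≅ (𝒳 ⊗ 𝒳)_K` followed by
the generic group law `(𝒳 ⊗ 𝒳)_K → 𝒳_K ⊗ 𝒳_K ≅ E ⊗ E → E ≅ 𝒳_K` transported along `e` is the identity.
[cite: BLRNeronModels1990, §4.2 (the unit section)] -/
theorem sliceOver_comp_mul_eq_id :
    (lift (toUnit _ ≫ η[E] ≫ e.inv) (𝟙 ((genericFibre R K).obj 𝒳)) ≫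
        Functor.LaxMonoidal.μ (genericFibre R K) 𝒳 𝒳) ≫
      (Functor.OplaxMonoidal.δ (genericFibre R K) 𝒳 𝒳 ≫ (e.hom ⊗ₘ e.hom) ≫ μ[E] ≫ e.inv) =
      𝟙 ((genericFibre R K).obj 𝒳) := by
  rw [Category.assoc, Functor.Monoidal.μ_δ_assoc, lift_map_assoc, Category.assoc, Category.assoc,
    e.inv_hom_id, Category.comp_id, Category.id_comp, MonObj.lift_comp_one_left_assoc, e.hom_inv_id]

set_option backward.isDefEq.respectTransparency false in
/-- **The unit slice at the level of schemes**: the underlying map of the slice `(ε, 𝟙)`, followed by the projection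
`(𝒳 ⊗ 𝒳)_K → 𝒳 ×_R 𝒳`, is `(x ∘ (𝒳_K → Spec K), 𝒳_K → 𝒳)`. [cite: BLRNeronModels1990, §4.2 (the unit section)] -/
theorem sliceOver_left_comp_fst :
    (lift (toUnit _ ≫ η[E] ≫ e.inv) (𝟙 ((genericFibre R K).obj 𝒳)) ≫
        Functor.LaxMonoidal.μ (genericFibre R K) 𝒳 𝒳).left ≫
      pullback.fst (𝒳 ⊗ 𝒳).hom (specGenericPoint R K) =
    (pullback.lift
      (pullback.snd 𝒳.hom (specGenericPoint R K) ≫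
        ((η[E].left ≫ e.inv.left) ≫ pullback.fst 𝒳.hom (specGenericPoint R K)))
      (pullback.fst 𝒳.hom (specGenericPoint R K)) (unitSlice_w 𝒳 E e) :
      pullback 𝒳.hom (specGenericPoint R K) ⟶ (𝒳 ⊗ 𝒳).left) := by
  apply pullback.hom_ext
  · rw [pullback.lift_fst, Over.comp_left, Category.assoc, Category.assoc]
    erw [Over.μ_pullback_left_fst_fst]
    rw [Over.lift_left, pullback.lift_fst_assoc, Over.comp_left, Over.comp_left, Over.toUnit_left]
    simp only [Category.assoc]
    rfl
  · rw [pullback.lift_snd, Over.comp_left, Category.assoc, Category.assoc]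
    erw [Over.μ_pullback_left_fst_snd]
    rw [Over.lift_left, pullback.lift_snd_assoc, Over.id_left]
    exact Category.id_comp _

variable [IsOpenImmersion (specGenericPoint R K)]

set_option backward.isDefEq.respectTransparency false in
/-- **The unit slice identity `m(ε, b) = b`** (pullback level).  Let `U₀ := (𝒳 ×_R 𝒳)_K ⊆ 𝒳 ×_R 𝒳` be the generic
fibre (an open), `D ⊇ U₀` and `m : D → 𝒳` a morphism which on `U₀` is the group law of `E` transported along
`e : 𝒳_K ≅ E` (`hgen`, the (W0) stub's hypothesis verbatim).  Then there is a morphism `i : 𝒳_K → U₀` — the slice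
`b ↦ (ε, b)`, i.e. `i` followed by `U₀ ⊆ 𝒳 ×_R 𝒳` is `(x ∘ (𝒳_K → Spec K), 𝒳_K → 𝒳)` with `x = ε` the unit
`K`-point — such that `i` followed by `m` is the inclusion `𝒳_K → 𝒳`: the left unit law `ε · b = b`.
[cite: BLRNeronModels1990, §4.2 (the unit section; evaluation of the cocycle along `ε`)] -/
theorem exists_unitSlice_comp_eq (D : (𝒳 ⊗ 𝒳).left.Opens)
    (hD : (𝒳 ⊗ 𝒳).hom ⁻¹ᵁ (specGenericPoint R K).opensRange ≤ D)
    (m : (D : Scheme.{u}) ⟶ 𝒳.left)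
    (hgen : (𝒳 ⊗ 𝒳).left.homOfLE hD ≫ m =
      (IsOpenImmersion.isoOfRangeEq (pullback.fst (𝒳 ⊗ 𝒳).hom (specGenericPoint R K))
          ((𝒳 ⊗ 𝒳).hom ⁻¹ᵁ (specGenericPoint R K).opensRange).ι (by
            rw [Scheme.Opens.range_ι]
            exact IsOpenImmersion.range_pullbackFst (specGenericPoint R K) (𝒳 ⊗ 𝒳).hom)).inv ≫
        (Functor.OplaxMonoidal.δ (genericFibre R K) 𝒳 𝒳 ≫ (e.hom ⊗ₘ e.hom) ≫ μ[E] ≫ e.inv).left ≫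
        pullback.fst 𝒳.hom (specGenericPoint R K)) :
    ∃ i : pullback 𝒳.hom (specGenericPoint R K) ⟶ ↑((𝒳 ⊗ 𝒳).hom ⁻¹ᵁ (specGenericPoint R K).opensRange),
      i ≫ ((𝒳 ⊗ 𝒳).hom ⁻¹ᵁ (specGenericPoint R K).opensRange).ι =
        (pullback.lift
          (pullback.snd 𝒳.hom (specGenericPoint R K) ≫
            ((η[E].left ≫ e.inv.left) ≫ pullback.fst 𝒳.hom (specGenericPoint R K)))
          (pullback.fst 𝒳.hom (specGenericPoint R K)) (unitSlice_w 𝒳 E e) :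
          pullback 𝒳.hom (specGenericPoint R K) ⟶ (𝒳 ⊗ 𝒳).left) ∧
      i ≫ (𝒳 ⊗ 𝒳).left.homOfLE hD ≫ m = pullback.fst 𝒳.hom (specGenericPoint R K) := by
  have hfac := IsOpenImmersion.isoOfRangeEq_hom_fac (pullback.fst (𝒳 ⊗ 𝒳).hom (specGenericPoint R K))
    ((𝒳 ⊗ 𝒳).hom ⁻¹ᵁ (specGenericPoint R K).opensRange).ι (by
      rw [Scheme.Opens.range_ι]
      exact IsOpenImmersion.range_pullbackFst (specGenericPoint R K) (𝒳 ⊗ 𝒳).hom)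
  generalize (IsOpenImmersion.isoOfRangeEq (pullback.fst (𝒳 ⊗ 𝒳).hom (specGenericPoint R K))
    ((𝒳 ⊗ 𝒳).hom ⁻¹ᵁ (specGenericPoint R K).opensRange).ι _) = ℓ at hgen hfac
  refine ⟨(lift (toUnit _ ≫ η[E] ≫ e.inv) (𝟙 ((genericFibre R K).obj 𝒳)) ≫
      Functor.LaxMonoidal.μ (genericFibre R K) 𝒳 𝒳).left ≫ ℓ.hom, ?_, ?_⟩
  · rw [Category.assoc, hfac]
    exact sliceOver_left_comp_fst 𝒳 E e
  · rw [Category.assoc, hgen, ℓ.hom_inv_id_assoc, ← Category.assoc, ← Over.comp_left,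
      sliceOver_comp_mul_eq_id, Over.id_left]
    exact Category.id_comp _

set_option backward.isDefEq.respectTransparency false in
/-- **The unit slice, lifted to `D`, with its three identities** (the shape consumed by the `hpin` producer):
for `D ⊇ U₀`, `m : D → 𝒳` generically the group law of `E` through `e` (`hgen`) and `ΦD = (pr₁, m) : D → 𝒳 ×_R 𝒳`
(`hΦ₁`, `hΦ₂`), the slice `iT : 𝒳_K → D`, `b ↦ (ε, b)`, satisfies: `iT` followed by `D ⊆ 𝒳 ×_R 𝒳` is
`(x ∘ (𝒳_K → Spec K), 𝒳_K → 𝒳)`; `iT` followed by `m` is the inclusion `𝒳_K → 𝒳` (`ε · b = b`); and `ΦD` fixes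
the slice, `iT ≫ ΦD = iT ≫ (D ⊆ 𝒳 ×_R 𝒳)` (`Φ(ε, b) = (ε, ε · b) = (ε, b)`).
[cite: BLRNeronModels1990, §4.2 (the unit section; evaluation of the cocycle along `ε`)] -/
theorem exists_unitSlice_liftD (D : (𝒳 ⊗ 𝒳).left.Opens)
    (hD : (𝒳 ⊗ 𝒳).hom ⁻¹ᵁ (specGenericPoint R K).opensRange ≤ D)
    (m : (D : Scheme.{u}) ⟶ 𝒳.left)
    (hgen : (𝒳 ⊗ 𝒳).left.homOfLE hD ≫ m =
      (IsOpenImmersion.isoOfRangeEq (pullback.fst (𝒳 ⊗ 𝒳).hom (specGenericPoint R K))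
          ((𝒳 ⊗ 𝒳).hom ⁻¹ᵁ (specGenericPoint R K).opensRange).ι (by
            rw [Scheme.Opens.range_ι]
            exact IsOpenImmersion.range_pullbackFst (specGenericPoint R K) (𝒳 ⊗ 𝒳).hom)).inv ≫
        (Functor.OplaxMonoidal.δ (genericFibre R K) 𝒳 𝒳 ≫ (e.hom ⊗ₘ e.hom) ≫ μ[E] ≫ e.inv).left ≫
        pullback.fst 𝒳.hom (specGenericPoint R K))
    (ΦD : (D : Scheme.{u}) ⟶ (𝒳 ⊗ 𝒳).left)
    (hΦ₁ : ΦD ≫ (fst 𝒳 𝒳).left = D.ι ≫ (fst 𝒳 𝒳).left) (hΦ₂ : ΦD ≫ (snd 𝒳 𝒳).left = m) :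
    ∃ iT : pullback 𝒳.hom (specGenericPoint R K) ⟶ (D : Scheme.{u}),
      iT ≫ D.ι =
        (pullback.lift
          (pullback.snd 𝒳.hom (specGenericPoint R K) ≫
            ((η[E].left ≫ e.inv.left) ≫ pullback.fst 𝒳.hom (specGenericPoint R K)))
          (pullback.fst 𝒳.hom (specGenericPoint R K)) (unitSlice_w 𝒳 E e) :
          pullback 𝒳.hom (specGenericPoint R K) ⟶ (𝒳 ⊗ 𝒳).left) ∧
      iT ≫ m = pullback.fst 𝒳.hom (specGenericPoint R K) ∧
      iT ≫ ΦD = iT ≫ D.ι := by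
  obtain ⟨i, hi₁, hi₂⟩ := exists_unitSlice_comp_eq 𝒳 E e D hD m hgen
  have h₁ : (i ≫ (𝒳 ⊗ 𝒳).left.homOfLE hD) ≫ D.ι =
      (pullback.lift
        (pullback.snd 𝒳.hom (specGenericPoint R K) ≫
          ((η[E].left ≫ e.inv.left) ≫ pullback.fst 𝒳.hom (specGenericPoint R K)))
        (pullback.fst 𝒳.hom (specGenericPoint R K)) (unitSlice_w 𝒳 E e) :
        pullback 𝒳.hom (specGenericPoint R K) ⟶ (𝒳 ⊗ 𝒳).left) := by
    rw [Category.assoc, Scheme.homOfLE_ι]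
    exact hi₁
  have h₂ : (i ≫ (𝒳 ⊗ 𝒳).left.homOfLE hD) ≫ m = pullback.fst 𝒳.hom (specGenericPoint R K) := by
    rw [Category.assoc]
    exact hi₂
  refine ⟨i ≫ (𝒳 ⊗ 𝒳).left.homOfLE hD, h₁, h₂, ?_⟩
  apply pullback.hom_ext
  · have h := hΦ₁
    rw [Over.fst_left] at h
    simp only [Category.assoc]
    rw [h]
  · have h := hΦ₂
    rw [Over.snd_left] at h
    simp only [Category.assoc]
    rw [h, hi₂, Scheme.homOfLE_ι_assoc, reassoc_of% hi₁, pullback.lift_snd]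

end Literature.AlgebraicGeometry.Motives

end
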